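import Mathlib
import Summits.CriticalPhenomena.PercolationContinuityZ3.Theorems.PercNearOneGluingNoHeavyLowerTailInternalEdgeGluing
import HarnessLib

/-!
# `NoHeavyLowerTail` (stmt-CriticalPhenomena-4575) — internal-edge gluing, II: the set bridge at the region and the
# Conjecture-3 forms

Support file (depth prover `nh-dp-blobmono`, respawn g5; `--supports stmt-CriticalPhenomena-4575`).  Companion of
`…InternalEdgeGluing.lean` (`internalEdgeGluing`: `μ(o ↔ A) − μ(o ↔ b) ≤ max_a μ_{G−E(R)}(a ↮ b)` for a closed
relay-free region `R ∋ o`, `G − E(R)` = pairs inside `R` deleted, ports kept).  No definitions, no sorries.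

* `internalEdge_setBridge` — `μ(R ↮ b) · μ_{G−E(R)}(a ↮ b) ≤ μ(a ↮ b)` for `a ∉ R` (Harris for two decreasing events,
  via `coreBridge` and `G − R ≤ G − E(R)`).
* `internalEdge_region_nearOneGluing` — **`μ(R ↮ b) ≤ μ(o ↮ A) + √t`** (`μ(a ↮ b) ≤ t` on `A`): either every relay is
  `√t`-reliable without the pairs inside `R` (then `internalEdgeGluing`), or the region itself reaches `b` with
  probability `≥ 1 − √t`.
* `internalEdge_observer_nearOneGluing` — for the observer: `μ(o ↮ b) ≤ μ(o ↮ A) + √t + Σ_{z ∈ R∖{o}} μ(o ↮ z)`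
  (the last sum is the cohesion defect of the region seen from `o`).
-/

namespace Summit.CriticalPhenomena.PercolationContinuityZ3.Theorems

open MeasureTheory Set
open Literature.Probability.LatticeModels (prodBernoulli prodBernoulli_real_mono_of_isUpperSet
  prodBernoulli_harris_lower)
open Literature.Probability.Percolation (BondConfig openConn openConnIn openGraph openGraph_adj
  isUpperSet_openConn isUpperSet_openConnIn)

noncomputable section
open Classical

variable {n : ℕ}

/-! ### 5. The set bridge at the region and the Conjecture-3 form -/

/-- **Set bridge at the region**: `μ(R ↮ b) · μ_{G−E(R)}(a ↮ b) ≤ μ(a ↮ b)` for `a ∉ R` (Harris for two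
decreasing events; an open `a–b` path using a pair inside `R` puts a vertex of `R` into `b`'s cluster).
[this work; cite: Grimmett1999, Thm. (2.4) p. 34] -/
theorem internalEdge_setBridge (w : Sym2 (Fin n) → unitInterval) (R : Finset (Fin n)) (a b : Fin n)
    (haR : a ∉ R) :
    (prodBernoulli w).real (⋃ r ∈ R, (openConn r b : Set (BondConfig (Fin n))))ᶜ *
        (prodBernoulli (fun e : Sym2 (Fin n) => if (∀ x ∈ e, x ∈ R) then 0 else w e)).real (openConn a b)ᶜ ≤
      (prodBernoulli w).real (openConn a b)ᶜ := by
  -- `G − E(R)` dominates `G − R`, so this follows from the core bridge with the vertex-deleted law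
  have hle : (fun e : Sym2 (Fin n) => if (∃ x ∈ e, x ∈ R) then (0 : unitInterval) else w e) ≤
      (fun e : Sym2 (Fin n) => if (∀ x ∈ e, x ∈ R) then 0 else w e) := by
    intro e
    show (if (∃ x ∈ e, x ∈ R) then (0 : unitInterval) else w e) ≤ (if (∀ x ∈ e, x ∈ R) then 0 else w e)
    by_cases h1 : ∃ x ∈ e, x ∈ R
    · rw [if_pos h1]; exact unitInterval.nonneg'
    · rw [if_neg h1]
      have h2 : ¬ ∀ x ∈ e, x ∈ R := by
        intro h
        induction e using Sym2.ind with
        | h x y => exact h1 ⟨x, Sym2.mem_mk_left x y, h x (Sym2.mem_mk_left x y)⟩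
      rw [if_neg h2]
  have hmono := prodBernoulli_real_mono_of_isUpperSet hle (isUpperSet_openConn a b) (pocketGlue_measurableSet _)
  have hc1 : (prodBernoulli (fun e : Sym2 (Fin n) => if (∀ x ∈ e, x ∈ R) then 0 else w e)).real (openConn a b)ᶜ ≤
      (prodBernoulli (fun e : Sym2 (Fin n) => if (∃ x ∈ e, x ∈ R) then 0 else w e)).real (openConn a b)ᶜ := by
    rw [probReal_compl_eq_one_sub (pocketGlue_measurableSet _),
      probReal_compl_eq_one_sub (pocketGlue_measurableSet _)]
    linarith
  calc _ ≤ (prodBernoulli w).real (⋃ r ∈ R, (openConn r b : Set (BondConfig (Fin n))))ᶜ *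
        (prodBernoulli (fun e : Sym2 (Fin n) => if (∃ x ∈ e, x ∈ R) then 0 else w e)).real (openConn a b)ᶜ :=
        mul_le_mul_of_nonneg_left hc1 measureReal_nonneg
    _ ≤ (prodBernoulli w).real (openConn a b)ᶜ := coreBridge w R a b haR

/-- **Conjecture 3 for the region, internal-edge form**: `μ(R ↮ b) ≤ μ(o ↮ A) + √t` whenever `μ(a ↮ b) ≤ t` on
`A` (`R ∋ o` closed, disjoint from `A ∋ b`). [this work; cite: KozmaNitzan2024, Conjecture 3 (p. 15)] -/
theorem internalEdge_region_nearOneGluing (w : Sym2 (Fin n) → unitInterval) (R A : Finset (Fin n)) (o b : Fin n)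
    (t : ℝ) (hbA : b ∈ A) (hoR : o ∈ R) (hRA : Disjoint R A)
    (hcl : ∀ x ∈ R, ∀ y : Fin n, y ∉ R → y ∉ A → w s(x, y) = 0)
    (hrel : ∀ a ∈ A, (prodBernoulli w).real (openConn a b)ᶜ ≤ t) :
    (prodBernoulli w).real (⋃ r ∈ R, (openConn r b : Set (BondConfig (Fin n))))ᶜ ≤
      (prodBernoulli w).real (⋃ a ∈ A, (openConn o a : Set (BondConfig (Fin n))))ᶜ + Real.sqrt t := by
  set μ := prodBernoulli w with hμ
  set kE : Sym2 (Fin n) → unitInterval := fun e => if (∀ x ∈ e, x ∈ R) then 0 else w e with hkE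
  have hAne : A.Nonempty := ⟨b, hbA⟩
  obtain ⟨aStar, haStar, hmax⟩ := Finset.exists_max_image A (fun a => (prodBernoulli kE).real (openConn a b)ᶜ) hAne
  set θ : ℝ := (prodBernoulli kE).real (openConn aStar b)ᶜ with hθ
  have ht0 : 0 ≤ t := le_trans measureReal_nonneg (hrel b hbA)
  have hglue := internalEdgeGluing w R A o b θ hbA hoR hRA hcl (fun a ha => hmax a ha)
  have haR : aStar ∉ R := fun h => Finset.disjoint_left.1 hRA h haStar
  have hbr : μ.real (⋃ r ∈ R, (openConn r b : Set (BondConfig (Fin n))))ᶜ * θ ≤ t :=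
    le_trans (internalEdge_setBridge w R aStar b haR) (hrel aStar haStar)
  -- `μ(R ↮ b) ≤ μ(o ↮ b) = 1 − μ(o ↔ b) ≤ 1 − μ(o ↔ A) + θ`
  have hRo : μ.real (⋃ r ∈ R, (openConn r b : Set (BondConfig (Fin n))))ᶜ ≤ μ.real (openConn o b)ᶜ := by
    refine measureReal_mono (fun ω hω hob => hω (Set.mem_iUnion₂.2 ⟨o, hoR, hob⟩)) (measure_ne_top μ _)
  have hcA : μ.real (⋃ a ∈ A, (openConn o a : Set (BondConfig (Fin n))))ᶜ =
      1 - μ.real (⋃ a ∈ A, (openConn o a : Set (BondConfig (Fin n)))) :=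
    probReal_compl_eq_one_sub (pocketGlue_measurableSet _)
  have hcb : μ.real (openConn o b)ᶜ = 1 - μ.real (openConn o b) :=
    probReal_compl_eq_one_sub (pocketGlue_measurableSet _)
  have h1 : μ.real (⋃ r ∈ R, (openConn r b : Set (BondConfig (Fin n))))ᶜ ≤
      μ.real (⋃ a ∈ A, (openConn o a : Set (BondConfig (Fin n))))ᶜ + θ := by
    rw [hcA]; rw [hcb] at hRo; linarith
  exact le_add_sqrt_of_dichotomy measureReal_nonneg ht0 h1 hbr

/-- **Conjecture 3 for an observer with a cohesive closed region** (internal-edge form): for `o ∈ R`,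
`μ(o ↮ b) ≤ μ(o ↮ A) + √t + Σ_{z ∈ R∖{o}} μ(o ↮ z)`. [this work; cite: KozmaNitzan2024, Conjecture 3 (p. 15)] -/
theorem internalEdge_observer_nearOneGluing (w : Sym2 (Fin n) → unitInterval) (R A : Finset (Fin n))
    (o b : Fin n) (t : ℝ) (hbA : b ∈ A) (hoR : o ∈ R) (hRA : Disjoint R A)
    (hcl : ∀ x ∈ R, ∀ y : Fin n, y ∉ R → y ∉ A → w s(x, y) = 0)
    (hrel : ∀ a ∈ A, (prodBernoulli w).real (openConn a b)ᶜ ≤ t) :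
    (prodBernoulli w).real (openConn o b)ᶜ ≤
      (prodBernoulli w).real (⋃ a ∈ A, (openConn o a : Set (BondConfig (Fin n))))ᶜ + Real.sqrt t +
        ∑ z ∈ R.erase o, (prodBernoulli w).real (openConn o z)ᶜ := by
  set μ := prodBernoulli w with hμ
  have hreg := internalEdge_region_nearOneGluing w R A o b t hbA hoR hRA hcl hrel
  have hsplit : (openConn o b : Set (BondConfig (Fin n)))ᶜ ⊆
      (⋃ r ∈ R, (openConn r b : Set (BondConfig (Fin n))))ᶜ ∪
        ⋃ z ∈ R.erase o, (openConn o z : Set (BondConfig (Fin n)))ᶜ := by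
    intro ω hob
    by_cases hRb : ω ∈ ⋃ r ∈ R, (openConn r b : Set (BondConfig (Fin n)))
    · right
      simp only [Set.mem_iUnion, exists_prop] at hRb ⊢
      obtain ⟨z, hz, hzb⟩ := hRb
      have hzo : z ≠ o := by rintro rfl; exact hob hzb
      exact ⟨z, Finset.mem_erase.2 ⟨hzo, hz⟩, fun hoz => hob (SimpleGraph.Reachable.trans hoz hzb)⟩
    · left; exact hRb
  have hm1 := measureReal_mono hsplit (measure_ne_top μ _)
  have hm2 : μ.real ((⋃ r ∈ R, (openConn r b : Set (BondConfig (Fin n))))ᶜ ∪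
        ⋃ z ∈ R.erase o, (openConn o z : Set (BondConfig (Fin n)))ᶜ) ≤
      μ.real (⋃ r ∈ R, (openConn r b : Set (BondConfig (Fin n))))ᶜ +
        μ.real (⋃ z ∈ R.erase o, (openConn o z : Set (BondConfig (Fin n)))ᶜ) := measureReal_union_le _ _
  have hm3 : μ.real (⋃ z ∈ R.erase o, (openConn o z : Set (BondConfig (Fin n)))ᶜ) ≤
      ∑ z ∈ R.erase o, μ.real (openConn o z)ᶜ := measureReal_biUnion_finset_le _ _
  linarith

end

end Summit.CriticalPhenomena.PercolationContinuityZ3.Theorems
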